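import Summits.CriticalPhenomena.SAWScalingLimit.Theses.SAWRestrictionRigidity
import Summits.CriticalPhenomena.SAWScalingLimit.Theorems.SAWRestrictionRigidityLimitExistsGeometric
import Summits.CriticalPhenomena.SAWScalingLimit.Theorems.SAWRestrictionRigidityLimitExistsCountable
import Summits.CriticalPhenomena.SAWScalingLimit.Theorems.SAWRestrictionRigidityLimitExistsCauchy
import Summits.CriticalPhenomena.SAWScalingLimit.Theorems.SAWRestrictionRigidityLimitExistsTightNecessity
import Literature.Geometry.Riemannian.MeasureLipschitzToolkit
import HarnessLib.Audit

/-!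
# Crux `LimitExists` (stmt-CriticalPhenomena-1371) — ALTERNATIVE line `dyadic_seam` (`Lines/dyadic_seam.lean`), skeleton v1

Strategist s2 (planner-cstrat-stmt-CriticalPhenomena-1371-s2-0, 2026-08-17).  An alternative to the live line
`registered` (`Lines/birth.lean`, lead c6) — it does NOT touch that skeleton and shares with it only the
necessary stub (T) = item stmt-CriticalPhenomena-1372.

## Idea

The live line is Billingsley's subsequence principle: (T) tightness + UNIQUENESS of subsequential limits, the
uniqueness coming from (S) simplicity of subsequential limits (stmt-4982) and (C) convergence of the avoidance
ratios (stmt-1369 ⟸ stmt-10649, strategist s1 there: no strategy short of the summit).  (S) and (C) are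
IDENTIFICATION-type inputs: they pin every subsequential limit by a characterising property.

This line never identifies anything.  By lead c6's landed seam
`limitExists_iff_geometric_and_meshContinuous` the crux is, observable by observable, (GEO) convergence along the
geometric meshes `t·2^{-k}` to a phase-independent limit ∧ (CONT) mesh continuity; and by lead c4's
`limitExists_iff_eventualTight_and_forall_mem_tendsto_integral` the observables may be cut down, MODULO (T), to any
class separating finite Borel measures — here the bounded LIPSCHITZ observables of the curve class
(`Literature.Geometry.Riemannian.ext_of_forall_integral_lipschitz_eq`), which are exactly the observables a
COUPLING controls (`|E f(γ) - E f(γ')| ≤ Lip f · E d(γ, γ')`).  The three remaining stubs are limit-free,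
`P`-free comparisons of TWO FINITE-MESH critical SAW measures of one domain, each the output shape of one
mechanism:

* (A) `stub_dyadicCauchy` — along the DYADIC meshes `2^{-k}` the critical expectations of a bounded Lipschitz
  observable form a Cauchy sequence.  Mechanism: a renormalisation / block coupling of the critical SAW of
  `Ω_{2^{-k-1}}` with that of `Ω_{2^{-k}}` (`2^{-k}ℤ² ⊆ 2^{-k-1}ℤ²`) with SUMMABLE errors
  (`cauchySeq_of_dist_le_of_summable` turns summable one-step errors into (A)).
* (B) `stub_phaseCovariance` — the critical expectations along the shifted geometric meshes `t·2^{-k}`,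
  `t ∈ [1, 2]`, merge with the dyadic ones: `E_{t/2^k} f - E_{1/2^k} f → 0`.  By the exact dilation identity
  `integral_law_geometric_eq_dyadic` (`E^{Ω}_{t/2^k}[f] = E^{t⁻¹Ω}_{2^{-k}}[f ∘ (t·)]`) this is DILATION COVARIANCE
  of the dyadic critical SAW between the domains `Ω` and `t⁻¹Ω` — the scale-invariance content of criticality,
  a rigidity-type statement about a one-parameter family of `×2`-covariant dyadic limits (route
  `SAWInfinitesimalRigidity`'s lever read at mesh level), or the output of a coupling across the
  INCOMMENSURABLE lattices `2^{-k}ℤ²` and `t·2^{-k}ℤ²`.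
* (M) `stub_meshContinuity` — MESH CONTINUITY (lead c6's (CONT), cut to Lipschitz observables): critical
  expectations at two small meshes of ratio close to `1` are close.  By `integral_law_dilate` it is continuity of
  the critical SAW laws under dilations of the DOMAIN close to the identity, uniformly in the small mesh — a
  cousin of the hub's domain-continuity items (`SAWRingGibbsDescent.DomainContinuity`, `SAWExpCovariance.DiscContinuity`).

Composition (`LimitExists_of`, sorry-free): (A) gives a dyadic limit `L` per observable
(`cauchySeq_tendsto_of_complete`), (B) transports it to every phase (so (GEO) with ONE `L`), (M) is (CONT); the
real-analysis lemma `exists_tendsto_nhdsGT_iff_geometric_and_ratioContinuous` gives convergence along the full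
filter `δ → 0⁺` for every bounded Lipschitz observable, and `limitExists_iff_eventualTight_and_forall_mem_tendsto_integral`
with the Lipschitz separating class and (T) gives the crux BY NAME.

Why it dodges the STUCK goals of the live line: no stub mentions subsequential limits, simplicity, avoidance
masses, `rangeSubset`, or the limit object `P`; (S) = stmt-4982 and (C) = stmt-1369/10649 are not used.  (T) is
necessary for the crux (`eventualTight_of_limitExists`), so no line can drop it.

Independence of the cut (abstract nets `u : ℝ → ℝ`, so no stub is implied by the other two):
`u δ = sin (2π log₂ δ)` has (A), (M), not (B); `u δ = sin √(log₂ δ⁻¹)` has (B), (M), not (A); a bump of height `1`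
at phase `1 + 1/k` and width `k⁻²` in octave `k` has (A), (B), not (M).  Necessity: all four stubs follow from the
crux (`stubs_of_limitExists` below, sorry-free), so none is refutable unless the crux is.

Disproof read: none exists for this crux (`ledger crux ls stmt-CriticalPhenomena-1371`: Lines/birth.*, PICKED.md only).
Negatives honoured: stmt-0772 (all-δ tightness, refuted) is not used — (T) is its `∃ δ₀` repair; every stub here is an
EVENTUAL (`δ < δ₀` / `k → ∞`) statement, per-domain and per-approximation (the uniform-over-domains forms refuted in
`Cruxes/EventualTight/Disproof.lean` are avoided).
-/

noncomputable section

open MeasureTheory Filter Topology Set Metric Function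
open Literature.Probability.RandomPlanarGeometry Literature.Probability.RandomPlanarGeometry.SAW
open Literature.Probability.LatticeModels
open scoped ENNReal NNReal BoundedContinuousFunction MeasureTheory Topology

namespace Summit.CriticalPhenomena.SAWScalingLimit.Cruxes.LimitExists.DyadicSeam

open Summit.CriticalPhenomena.SAWScalingLimit.Theses.SAWRestrictionRigidity
open Summit.CriticalPhenomena.SAWScalingLimit.Theorems.SAWRestrictionRigidityLimitExists

/-! ## The registered stubs -/

/-- **stub (T) — EVENTUAL TIGHTNESS** (verbatim the shared support item `EventualTight`,
stmt-CriticalPhenomena-1372; shared with line `registered`): for every Dobrushin domain and endpoint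
approximation there is `δ₀ > 0` such that the pushed-forward critical SAW laws for `δ ∈ (0, δ₀]` form a tight set
of measures on `CurveClass ℂ`.  OPEN (own crux chain, lead c10): needs an annulus-crossing / sub-ballistic
regularity bound for the critical SAW.  Necessary for the crux (`eventualTight_of_limitExists`).
Sources: KemppainenSmirnov2017 Thm 1.5, AizenmanBurchardDuke1999 Thm 1.1, DuminilCopinHammond2013. -/
theorem stub_eventualTight : ∀ (D : Literature.Probability.RandomPlanarGeometry.DobrushinDomain) (a b : ℝ → Literature.Probability.LatticeModels.Site 2), Literature.Probability.RandomPlanarGeometry.SAW.IsEndpointApprox D a b → ∃ δ₀ : ℝ, 0 < δ₀ ∧ MeasureTheory.IsTightMeasureSet ((fun δ => (Literature.Probability.RandomPlanarGeometry.SAW.law D.carrier δ (a δ) (b δ)).map (fun γ => γ.curve)) '' Set.Ioc 0 δ₀) := by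
  sorry

/-- **stub (A) — DYADIC CAUCHY** (new): for every Dobrushin domain, endpoint approximation and bounded
LIPSCHITZ observable `f` of the curve class, the critical expectations `E_{2^{-k}}[f(γ)]` along the dyadic meshes
form a Cauchy sequence.  Intended mechanism: a block / renormalisation coupling of the critical SAWs of `Ω` at
meshes `2^{-k}` and `2^{-k-1}` (nested lattices) whose coupling distance is summable in `k`
(`cauchySeq_of_dist_le_of_summable`).  OPEN: no cross-mesh coupling of critical planar SAW is in print; the
RG couplings that exist (Brydges–Slade, `d = 4`, weakly SAW) flow to a Gaussian fixed point.
Why it might fail: only through failure of the crux itself along dyadic meshes (it is implied by the crux).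
Sources: LawlerSchrammWerner2004SAW (arXiv:math/0204277) §1; BauerschmidtBrydgesSlade2019 (LNM 2242);
DuminilCopinSmirnov2012 (arXiv:1007.0575). -/
theorem stub_dyadicCauchy : ∀ (D : Literature.Probability.RandomPlanarGeometry.DobrushinDomain) (a b : ℝ → Literature.Probability.LatticeModels.Site 2), Literature.Probability.RandomPlanarGeometry.SAW.IsEndpointApprox D a b → ∀ (f : BoundedContinuousFunction (Literature.Probability.RandomPlanarGeometry.CurveClass ℂ) ℝ) (K : NNReal), LipschitzWith K f → CauchySeq (fun k : ℕ => ∫ γ, f γ.curve ∂(Literature.Probability.RandomPlanarGeometry.SAW.law D.carrier (1 / 2 ^ k) (a (1 / 2 ^ k)) (b (1 / 2 ^ k)))) := by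
  sorry

/-- **stub (B) — PHASE COVARIANCE** (new): for every Dobrushin domain, endpoint approximation, bounded
Lipschitz observable `f` and phase `t ∈ [1, 2]`, the critical expectations along the shifted geometric meshes
`t·2^{-k}` merge with the dyadic ones: `E_{t/2^k}[f(γ)] - E_{1/2^k}[f(γ)] → 0`.  By `integral_law_geometric_eq_dyadic`
the first term is the DYADIC critical expectation of the transported observable `f ∘ (t·)` in the shrunken domain
`t⁻¹·Ω`, so (B) is dilation covariance of the dyadic critical SAW between `Ω` and `t⁻¹Ω` — scale invariance of
the critical point beyond the lattice-exact factor `2`.  Intended mechanisms: rigidity of a `×2`-covariant,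
restriction-consistent one-parameter family of dyadic limits (route `SAWInfinitesimalRigidity`), or a coupling
across the incommensurable lattices `2^{-k}ℤ²`, `t 2^{-k}ℤ²`.  OPEN.
Why it might fail: a log-periodic (discretely but not continuously scale-invariant) dyadic limit — excluded only
by the crux itself, which implies (B).
Sources: LawlerSchrammWerner2003Restriction (arXiv:math/0209343) Thm 8.4; LawlerSchrammWerner2004SAW §3. -/
theorem stub_phaseCovariance : ∀ (D : Literature.Probability.RandomPlanarGeometry.DobrushinDomain) (a b : ℝ → Literature.Probability.LatticeModels.Site 2), Literature.Probability.RandomPlanarGeometry.SAW.IsEndpointApprox D a b → ∀ (f : BoundedContinuousFunction (Literature.Probability.RandomPlanarGeometry.CurveClass ℂ) ℝ) (K : NNReal), LipschitzWith K f → ∀ t ∈ Set.Icc (1 : ℝ) 2, Filter.Tendsto (fun k : ℕ => (∫ γ, f γ.curve ∂(Literature.Probability.RandomPlanarGeometry.SAW.law D.carrier (t / 2 ^ k) (a (t / 2 ^ k)) (b (t / 2 ^ k)))) - ∫ γ, f γ.curve ∂(Literature.Probability.RandomPlanarGeometry.SAW.law D.carrier (1 / 2 ^ k) (a (1 / 2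 ^ k)) (b (1 / 2 ^ k)))) Filter.atTop (nhds 0) := by
  sorry

/-- **stub (M) — MESH CONTINUITY on Lipschitz observables** (lead c6's clause (CONT) of
`limitExists_iff_geometric_and_meshContinuous`, cut down to bounded Lipschitz observables): for every Dobrushin
domain, endpoint approximation, bounded Lipschitz observable `f` and `ε > 0` there are `δ₀, η > 0` with
`|E_δ[f(γ)] - E_δ'[f(γ)]| < ε` for all meshes `δ, δ' ∈ (0, δ₀)` with `|δ'/δ - 1| < η`.  By `integral_law_dilate`
this is continuity of the critical SAW law under dilations of the DOMAIN by factors close to `1`, uniformly in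
the small mesh (a boundary-perturbation / domain-continuity statement; cf. items
`SAWRingGibbsDescent.DomainContinuity`, `SAWExpCovariance.DiscContinuity`).  OPEN.
Why it might fail: uniformity in the mesh of the boundary effect — a near-boundary pinning phenomenon at scale
`δ` whose probability oscillates with `log δ` would break it (and the crux).
Sources: LawlerSchrammWerner2004SAW §3.4; KennedyLawler2013 (arXiv:1109.3091); BeffaraPeltolaWu2021 (arXiv:1801.07699) §4. -/
theorem stub_meshContinuity : ∀ (D : Literature.Probability.RandomPlanarGeometry.DobrushinDomain) (a b : ℝ → Literature.Probability.LatticeModels.Site 2), Literature.Probability.RandomPlanarGeometry.SAW.IsEndpointApprox D a b → ∀ (f : BoundedContinuousFunction (Literature.Probability.RandomPlanarGeometry.CurveClass ℂ) ℝ) (K : NNReal), LipschitzWith K f → ∀ ε : ℝ, 0 < ε → ∃ δ₀ : ℝ, 0 < δ₀ ∧ ∃ η : ℝ, 0 < η ∧ ∀ δ δ' : ℝ, 0 < δ → δ < δ₀ → 0 < δ' → δ' < δ₀ → |δ' / δ - 1| < η → |(∫ γ, f γ.curve ∂(Literature.Probability.RandomPlanarGeometry.SAW.law D.carrier δ (a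 δ) (b δ))) - ∫ γ, f γ.curve ∂(Literature.Probability.RandomPlanarGeometry.SAW.law D.carrier δ' (a δ') (b δ'))| < ε := by
  sorry

/-! ## Name-keyed aliases of the stub statements (skeleton-check convention: the hypotheses of
`LimitExists_of` are exactly the declared stubs, each BY NAME) -/

namespace Registered

/-- Alias keyed by the stub name: the statement of `stub_eventualTight` (= item stmt-1372 `EventualTight`). -/
abbrev stub_eventualTight : Prop :=
  ∀ (D : Literature.Probability.RandomPlanarGeometry.DobrushinDomain) (a b : ℝ → Literature.Probability.LatticeModels.Site 2), Literature.Probability.RandomPlanarGeometry.SAW.IsEndpointApprox D a b → ∃ δ₀ : ℝ, 0 < δ₀ ∧ MeasureTheory.IsTightMeasureSet ((fun δ => (Literature.Probability.RandomPlanarGeometry.SAW.law D.carrier δ (a δ) (b δ)).map (fun γ => γ.curve)) '' Set.Ioc 0 δ₀)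

/-- Alias keyed by the stub name: the statement of `stub_dyadicCauchy`. -/
abbrev stub_dyadicCauchy : Prop :=
  ∀ (D : Literature.Probability.RandomPlanarGeometry.DobrushinDomain) (a b : ℝ → Literature.Probability.LatticeModels.Site 2), Literature.Probability.RandomPlanarGeometry.SAW.IsEndpointApprox D a b → ∀ (f : BoundedContinuousFunction (Literature.Probability.RandomPlanarGeometry.CurveClass ℂ) ℝ) (K : NNReal), LipschitzWith K f → CauchySeq (fun k : ℕ => ∫ γ, f γ.curve ∂(Literature.Probability.RandomPlanarGeometry.SAW.law D.carrier (1 / 2 ^ k) (a (1 / 2 ^ k)) (b (1 / 2 ^ k))))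

/-- Alias keyed by the stub name: the statement of `stub_phaseCovariance`. -/
abbrev stub_phaseCovariance : Prop :=
  ∀ (D : Literature.Probability.RandomPlanarGeometry.DobrushinDomain) (a b : ℝ → Literature.Probability.LatticeModels.Site 2), Literature.Probability.RandomPlanarGeometry.SAW.IsEndpointApprox D a b → ∀ (f : BoundedContinuousFunction (Literature.Probability.RandomPlanarGeometry.CurveClass ℂ) ℝ) (K : NNReal), LipschitzWith K f → ∀ t ∈ Set.Icc (1 : ℝ) 2, Filter.Tendsto (fun k : ℕ => (∫ γ, f γ.curve ∂(Literature.Probability.RandomPlanarGeometry.SAW.law D.carrier (t / 2 ^ k) (a (t / 2 ^ k)) (b (t / 2 ^ k)))) - ∫ γ, f γ.curve ∂(Literature.Probability.RandomPlanarGeometry.SAW.law D.carrier (1 / 2 ^ k) (a (1 / 2 ^ k)) (b (1 / 2 ^ k)))) Filter.atTop (nhds 0)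

/-- Alias keyed by the stub name: the statement of `stub_meshContinuity`. -/
abbrev stub_meshContinuity : Prop :=
  ∀ (D : Literature.Probability.RandomPlanarGeometry.DobrushinDomain) (a b : ℝ → Literature.Probability.LatticeModels.Site 2), Literature.Probability.RandomPlanarGeometry.SAW.IsEndpointApprox D a b → ∀ (f : BoundedContinuousFunction (Literature.Probability.RandomPlanarGeometry.CurveClass ℂ) ℝ) (K : NNReal), LipschitzWith K f → ∀ ε : ℝ, 0 < ε → ∃ δ₀ : ℝ, 0 < δ₀ ∧ ∃ η : ℝ, 0 < η ∧ ∀ δ δ' : ℝ, 0 < δ → δ < δ₀ → 0 < δ' → δ' < δ₀ → |δ' / δ - 1| < η → |(∫ γ, f γ.curve ∂(Literature.Probability.RandomPlanarGeometry.SAW.law D.carrier δ (a δ) (b δ))) - ∫ γ, f γ.curve ∂(Literature.Probability.RandomPlanarGeometry.SAW.law D.carrier δ' (a δ') (b δ'))| < ε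

end Registered

/-! ## Proved glue: bounded Lipschitz observables separate finite Borel measures on the curve space -/

/-- The separating class of this line: bounded continuous observables of the curve class that are Lipschitz
and `[0, 1]`-valued. -/
def lipUnit : Set (CurveClass ℂ →ᵇ ℝ) :=
  {f | (∃ K : ℝ≥0, LipschitzWith K f) ∧ ∀ x, f x ∈ Set.Icc (0 : ℝ) 1}

/-- **Lipschitz `[0, 1]`-valued observables separate finite Borel measures on `CurveClass ℂ`** (a metric
Borel space): `Literature.Geometry.Riemannian.ext_of_forall_integral_lipschitz_eq`, with a Lipschitz
`[0, 1]`-valued function packaged as a bounded continuous function. [folklore; Billingsley CPM Thm. 1.2] -/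
theorem lipUnit_separating : ∀ μ ν : Measure (CurveClass ℂ), IsFiniteMeasure μ → IsFiniteMeasure ν →
    (∀ f ∈ lipUnit, ∫ x, f x ∂μ = ∫ x, f x ∂ν) → μ = ν := by
  intro μ ν hμ hν h
  refine Literature.Geometry.Riemannian.ext_of_forall_integral_lipschitz_eq fun u K hK hu => ?_
  have hb : ∀ x, ‖u x‖ ≤ 1 := fun x => by
    rw [Real.norm_eq_abs, abs_le]
    exact ⟨by linarith [(hu x).1], (hu x).2⟩
  exact h (BoundedContinuousFunction.ofNormedAddCommGroup u hK.continuous 1 hb) ⟨⟨K, hK⟩, hu⟩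

/-! ## The composition: the crux BY NAME from the four stubs -/

/-- **(A) + (B) + (M) ⟹ every bounded Lipschitz critical expectation converges along `δ → 0⁺`.**
(A) gives the dyadic limit `L` (`ℝ` is complete), (B) moves it to every phase `t ∈ [1, 2]` — clause (GEO) of
`exists_tendsto_nhdsGT_iff_geometric_and_ratioContinuous` with one `L` — and (M) is its clause (CONT). [folklore] -/
theorem tendsto_integral_of_stubs (hA : Registered.stub_dyadicCauchy) (hB : Registered.stub_phaseCovariance)
    (hM : Registered.stub_meshContinuity) {D : DobrushinDomain} {a b : ℝ → Site 2}
    (hab : SAW.IsEndpointApprox D a b) (f : CurveClass ℂ →ᵇ ℝ) {K : ℝ≥0} (hK : LipschitzWith K f) :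
    ∃ L : ℝ, Tendsto (fun δ => ∫ γ, f γ.curve ∂(law D.carrier δ (a δ) (b δ))) (𝓝[>] (0 : ℝ)) (𝓝 L) := by
  refine (exists_tendsto_nhdsGT_iff_geometric_and_ratioContinuous
    (fun δ => ∫ γ, f γ.curve ∂(law D.carrier δ (a δ) (b δ)))).2 ⟨?_, ?_⟩
  · obtain ⟨L, hL⟩ := cauchySeq_tendsto_of_complete (hA D a b hab f K hK)
    refine ⟨L, fun t ht => ?_⟩
    have h := (hB D a b hab f K hK t ht).add hL
    simp only [zero_add, sub_add_cancel] at h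
    exact h
  · intro ε hε
    obtain ⟨δ₀, hδ₀, η, hη, h⟩ := hM D a b hab f K hK ε hε
    refine ⟨δ₀, hδ₀, η, hη, fun δ δ' h1 h2 h3 h4 h5 => ?_⟩
    rw [Real.dist_eq]
    exact h δ δ' h1 h2 h3 h4 h5

/-- **The composition: `LimitExists` BY NAME from the four registered stubs (T), (A), (B), (M).**
`limitExists_iff_eventualTight_and_forall_mem_tendsto_integral` (lead c4) with the Lipschitz separating class
`lipUnit`, (T), and `tendsto_integral_of_stubs`. [cite: BillingsleyCPM1999, Thm. 2.6] -/
theorem LimitExists_of (hT : Registered.stub_eventualTight) (hA : Registered.stub_dyadicCauchy)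
    (hB : Registered.stub_phaseCovariance) (hM : Registered.stub_meshContinuity) :
    Summit.CriticalPhenomena.SAWScalingLimit.Theses.SAWRestrictionRigidity.LimitExists := by
  refine (limitExists_iff_eventualTight_and_forall_mem_tendsto_integral lipUnit_separating).2 ⟨hT, ?_⟩
  intro D a b hab f hf
  obtain ⟨⟨K, hK⟩, -⟩ := hf
  exact tendsto_integral_of_stubs hA hB hM hab f hK

/-- Wiring check: the crux BY NAME from the four registered (sorried) stubs — shows the stub theorems are
exactly the hypotheses of `LimitExists_of` (this declaration inherits their `sorry`, nothing is claimed). -/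
theorem LimitExists_wiring :
    Summit.CriticalPhenomena.SAWScalingLimit.Theses.SAWRestrictionRigidity.LimitExists :=
  LimitExists_of stub_eventualTight stub_dyadicCauchy stub_phaseCovariance stub_meshContinuity

/-! Remark (other routes' copies).  The crux is the shared item stmt-CriticalPhenomena-1371; its copies
`Summit.CriticalPhenomena.SAWScalingLimit.Theses.<Route>.LimitExists` in the eight routes wanting it
(`SAWConePseudogroup`, `SAWExpCovariance`, `SAWGaussianRotation`, `SAWInfinitesimalRigidity`, `SAWPoissonBanks`,
`SAWPtolemyBoundary`, `SAWRestrictionDescent`, `SAWRestrictionRigidity`) have literally the same body, so each is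
obtained from `LimitExists_of` by `Iff.rfl`-transport (checked for `SAWInfinitesimalRigidity` and `SAWConePseudogroup` in the
strategist's folder; the route files are not imported here to keep this workfile independent of gate rewrites of those files). -/

/-! ## Pins and sanity (documentation, sorry-free) -/

/-- (T) is verbatim this route's support item `EventualTight` (stmt-CriticalPhenomena-1372). -/
theorem stub_eventualTight_iff_item1372 : Registered.stub_eventualTight ↔ EventualTight :=
  Iff.rfl

/-- **Necessity: every stub of this line follows from the crux** — so no stub is refutable unless the crux is,
and the cut loses nothing but the restriction to Lipschitz observables (which (T) restores).  (T) by
`eventualTight_of_limitExists`; (A), (B) from clause (GEO) and (M) from clause (CONT) of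
`limitExists_iff_geometric_and_meshContinuous`. [folklore] -/
theorem stubs_of_limitExists
    (h : Summit.CriticalPhenomena.SAWScalingLimit.Theses.SAWRestrictionRigidity.LimitExists) :
    Registered.stub_eventualTight ∧ Registered.stub_dyadicCauchy ∧ Registered.stub_phaseCovariance ∧
      Registered.stub_meshContinuity := by
  obtain ⟨hgeo, hcont⟩ := limitExists_iff_geometric_and_meshContinuous.1 h
  refine ⟨eventualTight_of_limitExists h, ?_, ?_, ?_⟩
  · intro D a b hab f K _
    obtain ⟨L, hL⟩ := hgeo D a b hab f
    exact (hL 1 ⟨le_rfl, one_le_two⟩).cauchySeq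
  · intro D a b hab f K _ t ht
    obtain ⟨L, hL⟩ := hgeo D a b hab f
    have h := (hL t ht).sub (hL 1 ⟨le_rfl, one_le_two⟩)
    rwa [sub_self] at h
  · intro D a b hab f K _ ε hε
    exact hcont D a b hab f ε hε

/-- **From a summable one-step coupling to (A).**  If at every dyadic scale the critical expectations of `f`
at meshes `2^{-k}` and `2^{-k-1}` differ by at most `ε k` with `∑ ε k < ∞` — the output of a block coupling
with summable coupling distance — then the dyadic expectations form a Cauchy sequence.
(`cauchySeq_of_dist_le_of_summable`.) [folklore] -/
theorem cauchySeq_of_summable_oneStep {u : ℕ → ℝ} {ε : ℕ → ℝ} (hε : Summable ε)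
    (h : ∀ k, |u (k + 1) - u k| ≤ ε k) : CauchySeq u := by
  refine cauchySeq_of_dist_le_of_summable ε (fun k => ?_) hε
  rw [Real.dist_eq, abs_sub_comm]
  exact h k

end Summit.CriticalPhenomena.SAWScalingLimit.Cruxes.LimitExists.DyadicSeam

end
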